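import Literature.Geometry.Riemannian.NonTrappingConvexSublevelProofs
import Mathlib.Analysis.SpecialFunctions.SmoothTransition
import HarnessLib

/-!
# Stub `stub_minimumPrinciple` (X_B) of line `collapsed-ends-usc` — one-variable calculus

Crux `EntropyRung.NoncompactShrinkerGap` (stmt-SmoothPoincare4-10868), line `collapsed-ends-usc`,
stub X_B (the localised minimum principle of Z.-H. Zhang, PAMS 137 (2009), proof of Thm. 1.3,
Step 1). This file holds the ONE-VARIABLE CALCULUS of the argument, with no geometry:

* `exists_cutoff`: a `C²` cut-off `ψ = η²`, `η(t) = smoothTransition (2 − 2t)`, with `ψ = 1` on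
  `(-∞, ½]`, `ψ = 0` on `[1, ∞)`, antitone, `ψ' ≤ 0`, and on `[0, 1]` the bounds `|ψ'|, |ψ''| ≤ K`
  and the quotient bound `ψ'² ≤ K ψ` (the reason for the square);
* `deriv_eq_zero_and_nonneg_of_isLocalMin`: at a local minimum `h'(0) = 0` and `h''(0) ≥ 0`
  (strict second-derivative test, `eventually_lt_of_hasDerivAt_deriv_pos`);
* `hasDerivAt_cutoff_mul`: the first two derivatives of `s ↦ ψ((T + a s + q s²)/A) · F(s)`;
* `cutoff_algebra`: the bookkeeping that turns the `k + 1` second-order conditions, Hamilton's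
  identity `Δ R = g⁻¹(dR, df) + R − 2|Ric|²` and `R² ≤ n |Ric|²` into `A · 2ψ|R| ≤ n K (3 + C⁺)`.

Everything is proved; no definitions, no named facts.
-/

noncomputable section

-- `Summit.SmoothPoincare4.SmoothPoincare4.…` (summit = problem) trips `dupNamespace` on every decl.
set_option linter.dupNamespace false

open scoped Topology ContDiff
open Set Filter

namespace Summit.SmoothPoincare4.SmoothPoincare4.Theorems.NoncompactShrinkerGapMinimumPrinciple

/-- **The cut-off of the localised minimum principle.** There are `C²` functions `ψ, ψ', ψ''`
(`ψ'` the derivative of `ψ`, `ψ''` that of `ψ'`) and a constant `K ≥ 0` with: `ψ` antitone,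
`ψ = 1` on `(-∞, ½]`, `ψ = 0` on `[1, ∞)`, `ψ ≥ 0`, `ψ' ≤ 0`, and on `[0, 1]`:
`|ψ'| ≤ K`, `|ψ''| ≤ K`, `ψ'² ≤ K ψ`. Construction: `ψ = η²` with
`η(t) = Real.smoothTransition (2 − 2t)`, so `ψ'² = 4η²η'² ≤ 4‖η'‖²_∞ ψ`. [folklore] -/
theorem exists_cutoff : ∃ (ψ ψ' ψ'' : ℝ → ℝ) (K : ℝ),
    (∀ t, HasDerivAt ψ (ψ' t) t) ∧ (∀ t, HasDerivAt ψ' (ψ'' t) t) ∧ Antitone ψ ∧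
    (∀ t, t ≤ 1 / 2 → ψ t = 1) ∧ (∀ t, 1 ≤ t → ψ t = 0) ∧ (∀ t, 0 ≤ ψ t) ∧ (∀ t, ψ' t ≤ 0) ∧
    0 ≤ K ∧ (∀ t ∈ Icc (0 : ℝ) 1, |ψ' t| ≤ K) ∧ (∀ t ∈ Icc (0 : ℝ) 1, |ψ'' t| ≤ K) ∧
    (∀ t ∈ Icc (0 : ℝ) 1, ψ' t ^ 2 ≤ K * ψ t) := by
  set η : ℝ → ℝ := fun t ↦ Real.smoothTransition (2 - 2 * t) with hη
  have hηs : ContDiff ℝ ∞ η :=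
    Real.smoothTransition.contDiff.comp (contDiff_const.sub (contDiff_const.mul contDiff_id))
  have hηd : Differentiable ℝ η := (contDiff_infty_iff_deriv.1 hηs).1
  have hη's : ContDiff ℝ ∞ (deriv η) := (contDiff_infty_iff_deriv.1 hηs).2
  have hη'd : Differentiable ℝ (deriv η) := (contDiff_infty_iff_deriv.1 hη's).1
  have hη''s : ContDiff ℝ ∞ (deriv (deriv η)) := (contDiff_infty_iff_deriv.1 hη's).2
  have h1 : ∀ t, HasDerivAt η (deriv η t) t := fun t ↦ (hηd t).hasDerivAt
  have h2 : ∀ t, HasDerivAt (deriv η) (deriv (deriv η) t) t := fun t ↦ (hη'd t).hasDerivAt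
  have hanti : Antitone η := fun a b hab ↦
    Real.smoothTransition.monotone (by linarith)
  have hone : ∀ t, t ≤ 1 / 2 → η t = 1 := fun t ht ↦
    Real.smoothTransition.one_of_one_le (by linarith)
  have hzero : ∀ t, 1 ≤ t → η t = 0 := fun t ht ↦
    Real.smoothTransition.zero_of_nonpos (by linarith)
  have hnn : ∀ t, 0 ≤ η t := fun t ↦ Real.smoothTransition.nonneg _
  have hle : ∀ t, η t ≤ 1 := fun t ↦ Real.smoothTransition.le_one _
  have hη'le : ∀ t, deriv η t ≤ 0 := fun t ↦ hanti.deriv_nonpos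
  -- bounds on `[0, 1]`
  obtain ⟨K₁, hK₁⟩ := isCompact_Icc.exists_bound_of_continuousOn (s := Icc (0 : ℝ) 1)
    hη's.continuous.continuousOn
  obtain ⟨K₂, hK₂⟩ := isCompact_Icc.exists_bound_of_continuousOn (s := Icc (0 : ℝ) 1)
    hη''s.continuous.continuousOn
  have hK₁' : ∀ t ∈ Icc (0 : ℝ) 1, |deriv η t| ≤ K₁ := fun t ht ↦ by
    simpa [Real.norm_eq_abs] using hK₁ t ht
  have hK₂' : ∀ t ∈ Icc (0 : ℝ) 1, |deriv (deriv η) t| ≤ K₂ := fun t ht ↦ by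
    simpa [Real.norm_eq_abs] using hK₂ t ht
  have hK₁0 : 0 ≤ K₁ := (abs_nonneg _).trans (hK₁' 0 ⟨le_rfl, zero_le_one⟩)
  have hK₂0 : 0 ≤ K₂ := (abs_nonneg _).trans (hK₂' 0 ⟨le_rfl, zero_le_one⟩)
  refine ⟨fun t ↦ η t * η t, fun t ↦ 2 * η t * deriv η t,
    fun t ↦ 2 * deriv η t * deriv η t + 2 * η t * deriv (deriv η) t,
    4 * K₁ ^ 2 + 2 * K₁ + 2 * K₂, fun t ↦ ?_, fun t ↦ ?_, fun a b hab ↦ ?_, fun t ht ↦ ?_,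
    fun t ht ↦ ?_, fun t ↦ mul_self_nonneg _, fun t ↦ ?_, by positivity, fun t ht ↦ ?_,
    fun t ht ↦ ?_, fun t ht ↦ ?_⟩
  · exact ((h1 t).fun_mul (h1 t)).congr_deriv (by ring)
  · exact ((h1 t).const_mul 2).fun_mul (h2 t)
  · exact mul_le_mul (hanti hab) (hanti hab) (hnn _) (hnn _)
  · simp [hone t ht]
  · simp [hzero t ht]
  · exact mul_nonpos_of_nonneg_of_nonpos (mul_nonneg zero_le_two (hnn t)) (hη'le t)
  · rw [abs_mul, abs_mul, abs_of_nonneg (zero_le_two : (0 : ℝ) ≤ 2), abs_of_nonneg (hnn t)]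
    have := hK₁' t ht
    have h3 : 2 * η t * |deriv η t| ≤ 2 * 1 * K₁ :=
      mul_le_mul (by linarith [hle t]) this (abs_nonneg _) (by norm_num)
    nlinarith
  · have ha := hK₁' t ht
    have hb := hK₂' t ht
    have h3 : |2 * deriv η t * deriv η t| ≤ 2 * K₁ ^ 2 := by
      rw [abs_mul, abs_mul, abs_of_nonneg (zero_le_two : (0 : ℝ) ≤ 2)]
      nlinarith [abs_nonneg (deriv η t)]
    have h4 : |2 * η t * deriv (deriv η) t| ≤ 2 * K₂ := by
      rw [abs_mul, abs_mul, abs_of_nonneg (zero_le_two : (0 : ℝ) ≤ 2), abs_of_nonneg (hnn t)]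
      have : 2 * η t * |deriv (deriv η) t| ≤ 2 * 1 * K₂ :=
        mul_le_mul (by linarith [hle t]) hb (abs_nonneg _) (by norm_num)
      linarith
    calc |2 * deriv η t * deriv η t + 2 * η t * deriv (deriv η) t|
        ≤ |2 * deriv η t * deriv η t| + |2 * η t * deriv (deriv η) t| := abs_add_le _ _
      _ ≤ 2 * K₁ ^ 2 + 2 * K₂ := add_le_add h3 h4
      _ ≤ 4 * K₁ ^ 2 + 2 * K₁ + 2 * K₂ := by nlinarith
  · have ha := hK₁' t ht
    have hsq : deriv η t ^ 2 ≤ K₁ ^ 2 := by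
      have := abs_le_abs_of_nonneg (abs_nonneg (deriv η t)) ha
      nlinarith [abs_nonneg (deriv η t), sq_abs (deriv η t)]
    have hψ0 : 0 ≤ η t * η t := mul_self_nonneg _
    calc (2 * η t * deriv η t) ^ 2 = 4 * deriv η t ^ 2 * (η t * η t) := by ring
      _ ≤ 4 * K₁ ^ 2 * (η t * η t) := by gcongr
      _ ≤ (4 * K₁ ^ 2 + 2 * K₁ + 2 * K₂) * (η t * η t) := by gcongr; nlinarith

/-- **First- and second-order conditions at a local minimum** (strict second-derivative test):
if `h` has derivative `h'` near `0`, `h'` has derivative `L` at `0`, and `h` has a local minimum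
at `0`, then `h' 0 = 0` (Fermat) and `0 ≤ L` — were `L < 0`, `-h` would have a STRICT local
minimum at `0` (`eventually_lt_of_hasDerivAt_deriv_pos`), contradicting the minimum of `h` at the
points `t ≠ 0` nearby. [folklore] -/
theorem deriv_eq_zero_and_nonneg_of_isLocalMin {h h' : ℝ → ℝ} {L : ℝ} (hmin : IsLocalMin h 0)
    (hd : ∀ᶠ s in 𝓝 (0 : ℝ), HasDerivAt h (h' s) s) (hd2 : HasDerivAt h' L 0) :
    h' 0 = 0 ∧ 0 ≤ L := by
  have h0 : h' 0 = 0 := hmin.hasDerivAt_eq_zero hd.self_of_nhds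
  refine ⟨h0, ?_⟩
  by_contra hL
  push Not at hL
  have hneg : ∀ᶠ s in 𝓝 (0 : ℝ), HasDerivAt (fun s ↦ -h s) ((fun s ↦ -h' s) s) s :=
    hd.mono fun s hs ↦ hs.neg
  have hev := Literature.Geometry.Lorentzian.eventually_lt_of_hasDerivAt_deriv_pos
    (u := fun s ↦ -h s) (u' := fun s ↦ -h' s) hneg hd2.neg (by simp [h0]) (by linarith)
  have hmin' : ∀ᶠ s in 𝓝[≠] (0 : ℝ), h 0 ≤ h s := nhdsWithin_le_nhds hmin
  obtain ⟨s, hs1, hs2⟩ := (hev.and hmin').exists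
  simp only [neg_lt_neg_iff] at hs1
  linarith

/-- **Derivatives of the test functions `h(s) = ψ((T + a s + q s²)/A) · F(s)`** of the localised
minimum principle: if `ψ' = dψ`, `ψ'' = dψ'`, `F' = F₁` everywhere and `F₁'(0) = F₂`, then
`h' = ψ'(β/A) (β'/A) F + ψ(β/A) F₁` everywhere (`β = T + a s + q s²`) and
`h''(0) = (ψ''(T/A) (a/A)² + ψ'(T/A) (2q/A)) F(0) + 2 ψ'(T/A) (a/A) F₁(0) + ψ(T/A) F₂`
(product and chain rules). [folklore] -/
theorem hasDerivAt_cutoff_mul {ψ ψ' ψ'' F F₁ : ℝ → ℝ} {F₂ : ℝ} (T a q A : ℝ)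
    (hψ : ∀ t, HasDerivAt ψ (ψ' t) t) (hψ' : ∀ t, HasDerivAt ψ' (ψ'' t) t)
    (hF : ∀ s, HasDerivAt F (F₁ s) s) (hF₁ : HasDerivAt F₁ F₂ 0) :
    (∀ s, HasDerivAt (fun s ↦ ψ ((T + a * s + q * s ^ 2) / A) * F s)
        (ψ' ((T + a * s + q * s ^ 2) / A) * ((a + 2 * q * s) / A) * F s
          + ψ ((T + a * s + q * s ^ 2) / A) * F₁ s) s) ∧
      HasDerivAt (fun s ↦ ψ' ((T + a * s + q * s ^ 2) / A) * ((a + 2 * q * s) / A) * F s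
          + ψ ((T + a * s + q * s ^ 2) / A) * F₁ s)
        ((ψ'' (T / A) * (a / A) ^ 2 + ψ' (T / A) * (2 * q / A)) * F 0
          + 2 * ψ' (T / A) * (a / A) * F₁ 0 + ψ (T / A) * F₂) 0 := by
  have hθ : ∀ s, HasDerivAt (fun s ↦ (T + a * s + q * s ^ 2) / A) ((a + 2 * q * s) / A) s := by
    intro s
    have h := (((hasDerivAt_id' s).const_mul a).const_add T).add ((hasDerivAt_pow 2 s).const_mul q)
    exact (h.div_const A).congr_deriv (by push_cast; ring)
  have hθ' : HasDerivAt (fun s ↦ (a + 2 * q * s) / A) (2 * q / A) 0 := by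
    have h := ((hasDerivAt_id' (0 : ℝ)).const_mul (2 * q)).const_add a
    exact (h.div_const A).congr_deriv (by ring)
  have hP : ∀ s, HasDerivAt (fun s ↦ ψ ((T + a * s + q * s ^ 2) / A))
      (ψ' ((T + a * s + q * s ^ 2) / A) * ((a + 2 * q * s) / A)) s := fun s ↦
    (hψ _).comp s (hθ s)
  have hP' : ∀ s, HasDerivAt (fun s ↦ ψ' ((T + a * s + q * s ^ 2) / A))
      (ψ'' ((T + a * s + q * s ^ 2) / A) * ((a + 2 * q * s) / A)) s := fun s ↦
    (hψ' _).comp s (hθ s)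
  refine ⟨fun s ↦ (hP s).fun_mul (hF s), ?_⟩
  have h := (((hP' 0).fun_mul hθ').fun_mul (hF 0)).fun_add ((hP 0).fun_mul hF₁)
  have e1 : (T + a * 0 + q * 0 ^ 2) / A = T / A := by ring
  have e2 : (a + 2 * q * 0) / A = a / A := by ring
  rw [e1, e2] at h
  exact h.congr_deriv (by ring)

/-- **The bookkeeping of Zhang's minimum principle** (Zhang 2009, proof of Thm. 1.3, Step 1). At the
negative minimum `x_m` of `ψ(d/A) R`, write `Ψ = ψ(d(x_m)/A) > 0`, `Ψ' ≤ 0`, `Ψ''`, `S = R(x_m) < 0`,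
and for the orthonormal frame `e_o` headed by `e_{o₀}`: `a_o = [o = o₀]`, `Rv_o = dR(e_o)`,
`Rvv_o = Hess R(e_o, e_o)`, `fv_o = df(e_o)`. If every test function `h_o` has `h_o'(0) = 0` (`h1`)
and `h_o''(0) ≥ 0` (`h2`), Hamilton's identity reads `Σ Rvv = Σ Rv·fv + S − 2N` (`N = |Ric|²`,
traces in the frame), `S² ≤ d N`, and the comparison constant bounds `2 Σ q_o − fv_{o₀} ≤ C`, then
`A · 2Ψ|S| ≤ d K (3 + C⁺)` where `K` bounds `|Ψ'|, |Ψ''|, Ψ'²/Ψ` and `A ≥ 1`. [folklore] -/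
theorem cutoff_algebra {ι : Type*} [Fintype ι] (o₀ : ι) {a q Rv Rvv fv : ι → ℝ}
    {Ψ Ψ' Ψ'' A S N K C d : ℝ} (ha₀ : a o₀ = 1) (ha : ∀ o, o ≠ o₀ → a o = 0)
    (hΨ : 0 < Ψ) (hΨ' : Ψ' ≤ 0) (hK1 : |Ψ'| ≤ K) (hK2 : |Ψ''| ≤ K) (hK3 : Ψ' ^ 2 ≤ K * Ψ)
    (hA : 1 ≤ A) (hS : S < 0)
    (h1 : ∀ o, Ψ' * (a o / A) * S + Ψ * Rv o = 0)
    (h2 : ∀ o, 0 ≤ (Ψ'' * (a o / A) ^ 2 + Ψ' * (2 * q o / A)) * S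
      + 2 * Ψ' * (a o / A) * Rv o + Ψ * Rvv o)
    (hHam : ∑ o, Rvv o = ∑ o, Rv o * fv o + S - 2 * N)
    (hCS : S ^ 2 ≤ d * N) (hd : 0 ≤ d) (hC : 2 * ∑ o, q o - fv o₀ ≤ C) :
    A * (2 * Ψ * -S) ≤ d * K * (3 + max C 0) := by
  classical
  have hA0 : 0 < A := by linarith
  have hB0 : 0 < A⁻¹ := inv_pos.2 hA0
  have hB1 : A⁻¹ ≤ 1 := inv_le_one_of_one_le₀ hA
  have hAB : A * A⁻¹ = 1 := mul_inv_cancel₀ hA0.ne'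
  simp only [div_eq_mul_inv] at h1 h2
  -- `Rv o = 0` off `o₀`, `Ψ Rv o₀ = -Ψ' S / A`
  have hRv : ∀ o, o ≠ o₀ → Rv o = 0 := fun o ho ↦ by
    have h := h1 o
    rw [ha o ho] at h
    simp only [zero_mul, mul_zero, zero_add] at h
    exact (mul_eq_zero.1 h).resolve_left hΨ.ne'
  have hP : Ψ * Rv o₀ = -(Ψ' * A⁻¹ * S) := by
    have h := h1 o₀
    rw [ha₀] at h
    linear_combination h
  -- sum of the second-order conditions
  have hsum : 0 ≤ ∑ o, ((Ψ'' * (a o * A⁻¹) ^ 2 + Ψ' * (2 * q o * A⁻¹)) * S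
      + 2 * Ψ' * (a o * A⁻¹) * Rv o + Ψ * Rvv o) := Finset.sum_nonneg fun o _ ↦ h2 o
  have hpt : ∀ o, (Ψ'' * (a o * A⁻¹) ^ 2 + Ψ' * (2 * q o * A⁻¹)) * S
      + 2 * Ψ' * (a o * A⁻¹) * Rv o + Ψ * Rvv o =
      (if o = o₀ then Ψ'' * A⁻¹ ^ 2 * S + 2 * Ψ' * A⁻¹ * Rv o₀ else 0)
        + (2 * Ψ' * A⁻¹ * S) * q o + Ψ * Rvv o := by
    intro o
    by_cases ho : o = o₀
    · subst ho
      rw [if_pos rfl, ha₀]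
      ring
    · rw [if_neg ho, ha o ho, hRv o ho]
      ring
  have hRf : ∑ o, Rv o * fv o = Rv o₀ * fv o₀ :=
    Finset.sum_eq_single o₀ (fun o _ ho ↦ by rw [hRv o ho, zero_mul])
      (fun h ↦ (h (Finset.mem_univ _)).elim)
  simp only [hpt, Finset.sum_add_distrib, Finset.sum_ite_eq', Finset.mem_univ, if_true,
    ← Finset.mul_sum, hHam, hRf] at hsum
  -- multiply by `Ψ > 0` and substitute `Ψ Rv o₀`
  have hx := mul_nonneg hΨ.le hsum
  have heq : Ψ * (Ψ'' * A⁻¹ ^ 2 * S + 2 * Ψ' * A⁻¹ * Rv o₀ + 2 * Ψ' * A⁻¹ * S * ∑ o, q o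
      + Ψ * (Rv o₀ * fv o₀ + S - 2 * N)) =
      S * (Ψ * Ψ'' * A⁻¹ ^ 2 + Ψ * Ψ' * A⁻¹ * (2 * ∑ o, q o - fv o₀) - 2 * Ψ' ^ 2 * A⁻¹ ^ 2
        + Ψ ^ 2) - 2 * Ψ ^ 2 * N := by
    linear_combination (2 * Ψ' * A⁻¹ + Ψ * fv o₀) * hP
  rw [heq] at hx
  -- bound the bracket
  have hK0 : 0 ≤ K := (abs_nonneg _).trans hK1
  have hΨ'abs : -Ψ' ≤ K := (neg_le_abs Ψ').trans hK1
  have hΨ''abs : -Ψ'' ≤ K := (neg_le_abs Ψ'').trans hK2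
  have hC0 : 0 ≤ max C 0 := le_max_right _ _
  have hQC : 2 * ∑ o, q o - fv o₀ ≤ max C 0 := hC.trans (le_max_left _ _)
  have t1 : -(Ψ * Ψ'' * A⁻¹ ^ 2) ≤ Ψ * A⁻¹ ^ 2 * K := by
    have := mul_le_mul_of_nonneg_left hΨ''abs (by positivity : 0 ≤ Ψ * A⁻¹ ^ 2)
    linarith
  have t2 : -(Ψ * Ψ' * A⁻¹ * (2 * ∑ o, q o - fv o₀)) ≤ Ψ * A⁻¹ * (K * max C 0) := by
    have s1 : (-Ψ') * (2 * ∑ o, q o - fv o₀) ≤ (-Ψ') * max C 0 :=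
      mul_le_mul_of_nonneg_left hQC (by linarith)
    have s2 : (-Ψ') * max C 0 ≤ K * max C 0 := mul_le_mul_of_nonneg_right hΨ'abs hC0
    have s4 := mul_le_mul_of_nonneg_left (s1.trans s2) (by positivity : 0 ≤ Ψ * A⁻¹)
    linarith
  have t3 : 2 * Ψ' ^ 2 * A⁻¹ ^ 2 ≤ 2 * A⁻¹ ^ 2 * (K * Ψ) :=
    by have := mul_le_mul_of_nonneg_left hK3 (by positivity : (0 : ℝ) ≤ 2 * A⁻¹ ^ 2); linarith
  have t4 : 0 ≤ Ψ ^ 2 := sq_nonneg _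
  have t5 : Ψ * K * A⁻¹ ^ 2 ≤ Ψ * K * A⁻¹ := by
    have := mul_le_mul_of_nonneg_left hB1 (by positivity : 0 ≤ Ψ * K * A⁻¹)
    linarith
  have hW : -(Ψ * Ψ'' * A⁻¹ ^ 2 + Ψ * Ψ' * A⁻¹ * (2 * ∑ o, q o - fv o₀) - 2 * Ψ' ^ 2 * A⁻¹ ^ 2
      + Ψ ^ 2) ≤ Ψ * A⁻¹ * K * (3 + max C 0) := by linarith
  -- `S² ≤ d N`, `2Ψ²N ≤ S W`
  have hσ : 0 < -S := by linarith
  have h6a : 2 * Ψ ^ 2 * S ^ 2 ≤ 2 * Ψ ^ 2 * (d * N) := mul_le_mul_of_nonneg_left hCS (by positivity)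
  have h6b : d * (2 * Ψ ^ 2 * N) ≤ d * (S * (Ψ * Ψ'' * A⁻¹ ^ 2
      + Ψ * Ψ' * A⁻¹ * (2 * ∑ o, q o - fv o₀) - 2 * Ψ' ^ 2 * A⁻¹ ^ 2 + Ψ ^ 2)) :=
    mul_le_mul_of_nonneg_left (by linarith) hd
  have h6c := mul_le_mul_of_nonneg_left hW (mul_nonneg hd hσ.le)
  have h6 : 2 * Ψ ^ 2 * S ^ 2 ≤ d * (-S) * (Ψ * A⁻¹ * K * (3 + max C 0)) := by linarith
  have h7 : 2 * Ψ * (-S) ≤ d * A⁻¹ * K * (3 + max C 0) := by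
    have hpos : 0 < Ψ * (-S) := mul_pos hΨ hσ
    refine le_of_mul_le_mul_left ?_ hpos
    linarith
  calc A * (2 * Ψ * -S) ≤ A * (d * A⁻¹ * K * (3 + max C 0)) := mul_le_mul_of_nonneg_left h7 hA0.le
    _ = (A * A⁻¹) * (d * K * (3 + max C 0)) := by ring
    _ = d * K * (3 + max C 0) := by rw [hAB, one_mul]

/-- **Registered sub-goal `stub_minimumPrincipleCutoff` of the crux** (the deciding statement of
this file): the `C²` cut-off of the localised minimum principle exists (`exists_cutoff`). [folklore] -/
theorem stub_minimumPrincipleCutoff : ∃ (ψ ψ' ψ'' : ℝ → ℝ) (K : ℝ), (∀ t, HasDerivAt ψ (ψ' t) t) ∧ (∀ t, HasDerivAt ψ' (ψ'' t) t) ∧ Antitone ψ ∧ (∀ t : ℝ, t ≤ 1 / 2 → ψ t = 1) ∧ (∀ t : ℝ, 1 ≤ t → ψ t = 0) ∧ (∀ t, 0 ≤ ψ t) ∧ (∀ t, ψ' t ≤ 0) ∧ 0 ≤ K ∧ (∀ t ∈ Set.Icc (0 : ℝ) 1, |ψ' t| ≤ K) ∧ (∀ t ∈ Set.Icc (0 :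 ℝ) 1, |ψ'' t| ≤ K) ∧ (∀ t ∈ Set.Icc (0 : ℝ) 1, ψ' t ^ 2 ≤ K * ψ t) :=
  exists_cutoff

end Summit.SmoothPoincare4.SmoothPoincare4.Theorems.NoncompactShrinkerGapMinimumPrinciple

end
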